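import Summits.QuantumFields.YangMills.Theorems.BalabanUVNodesN11AFibreDominationOnSupport

/-!
# DAG node N11 — THE JOINT-SUPPORT ROOTS UNDER PRINT'S TWO-SCALE LOCALITY OF `ζ_j` IN THE **FINE** FORM (scale `j` and the GAUGE component of scale `j+1`):
# n11-w4's congruence ∕ integrability roots on the JOINT SUPPORT (p598996 §1∕§2) with `hζloc : ω j = ω′ j → (ω (j+1)).1 = (ω′ (j+1)).1 → ζ_j(…)(ω) = ζ_j(…)(ω′)`
# — exactly the shape of node00's `TkResidualW.LocalLaws₂.zeta0_local₂` (p692453) and of 12b's row `zeta0_local` AFTER the FLAG №1 R2b cure (T1′)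

HEADER — WORK-UNIT METADATA.  Cell `pub-ymgap`, YM-PLAN Track A (HUMAN RULING D-0062), seat `pub-ymgap-dag-n11-d` (g32) on NODE n11 [B14]; route `BalabanUVNodes`,
item K1⁹ `StabilityBRunRowsAtRecordR13SepCoPHV` = stmt-QuantumFields-27364 (helper, `--kind proof --supports 27364 --as helper`, count-neutral).  Sibling of
`…N11TwoScaleLocalityJointSupport` (p703718: the same two roots under the COARSE form `ω (j+1) = ω′ (j+1)`), which cannot serve
`…N11AFibreDominationOnJointSupport` (it imports that file); this module sits UPSTREAM of it (imports `…AFibreDominationOnSupport` only), so the θ-level corollaries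
of `…N11AFibreDominationOnJointSupport` §4 can be re-proved through it with `hloc.localLaws₂.zeta0_local₂` — a proof that elaborates under 12b's row of record
(one-scale) AND under its two-scale re-typing (FLAG №1 W2, director-ym №272∕№278).  [III] = [Balaban1988Convergent].

WHY (located, count-neutral).  [III] p.264 bottom ∕ (3.2) p.265 ∕ p.267: `ζ(Ω^c_{k+1})` READS THE NEW GAUGE FIELD `V_{k+1}` = `(ω (k+1)).1` in 11a's indexing, and nothing
of `A_{k+1}`.  Inside `𝐓_k`, generation `m` modifies component `m` only and `ζ_i` (`i > m`) is compared at configurations differing at component `m < i` — so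
components `i` and `(i+1).1` agree and the fine law suffices (ONE `by rw` discharges the extra premise).  Proofs = p703718 §1∕§2 VERBATIM otherwise.

WHAT THIS FILE PROVES (0 `sorry`, 0 `def`; standard axioms).
§1 ★★ `tkBranchOfRecord_congr_on_joint_support_fine₂` — p598996 §1 under the fine two-scale `hζloc`.
§2 ★★ `integrable_front_mul_tkBranchOfRecord_baseCfg_of_dominated_on_joint_support_fine₂` — p598996 §2 over §1.

HONEST FRAMING.  Helper lane of K1⁹; generalizations (weaker hypothesis) of accepted tree theorems, proofs verbatim modulo one premise; no law of record is edited
or posited; nothing re-keyed.  Nothing of Bałaban asserted or refuted; K1⁹ `∃θ` NOT refuted; N11 NOT discharged; counts unmoved (discharged 8∕27).  One finite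
four-torus programme at fixed `ε = L^{−K}`; NOT ℝ⁴, NOT OS, NOT a mass gap, NOT Clay.  No `sorry`, `axiom`, `def`, `instance`, `notation`.
Sources (SHAPE only): [III] (2.10) p.256, (2.18) p.257, (2.20)–(2.23) p.258, (3.2)–(3.4) p.265, p.267, (3.23)–(3.24) p.270.
-/

noncomputable section

open MeasureTheory
open scoped BigOperators ENNReal NNReal Matrix.Norms.L2Operator

namespace Summit.QuantumFields.YangMills.Theorems.BalabanUVNodesN11JointSupportFineTwoScaleRoots

open Literature.MathematicalPhysics.QuantumFieldTheory.Balaban1983to89 T4Continuum T4NestedCovariance T4AdjointCovariance Node00 Node00.Tk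
open B15DeterminingSets (MSField)
open B10Eq42TorusConstraint (bondsIn)
open BalabanUVNodesN11TkBranchMassBound (integrable_tkBranchOfRecord_baseCfg_of_dominated)

section S1

variable {F : T4Family} {N : ℕ} [NeZero N] {V : Type} [NormedAddCommGroup V] [InnerProductSpace ℝ V] [FiniteDimensional ℝ V]
  [MeasurableSpace V] [BorelSpace V]
variable (ν : Stage7Numerics) (M : ℕ) (g : ℕ → ℝ) (K : ℕ)

/-- **★★ (FINE TWO-SCALE EDITION of p598996 §1 — `hζloc` reads scale `j` and the GAUGE component of scale `j+1` only) CONGRUENCE OF THE BRANCH OPERATORS ON THE JOINT SUPPORT.**  Two weight data `W, W′` with the same `ζ_j((Ω_{j+1})ᶜ)` below `k`, each `ζ_i` reading the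
scale-`i` configuration and the scale-`(i+1)` GAUGE component only (`i < k`; print's (3.2)–(3.4): `ζ(Ω^c_{k+1})` reads `V_{k+1}`), and A-weights agreeing — `w′_j(Λ_{j+1}, Λᶜ_{j+1}∩Ω_{j+1}, S_{j+1}) = w_j(…)` at `ω′` — whenever `ω′` satisfies an ambient predicate
`Amb` (stable under changes of the components `< k`) and the JOINT SUPPORT condition «for every `i` with `j ≤ i < k` there is a scale-`i` configuration `c` agreeing with
`ω′ i` in the gauge part and in the fluctuation part off the A-bonds `bondsIn i (Λᶜ_{i+1}∩Ω_{i+1})`, with `ζ_i((Ω_{i+1})ᶜ)(ω′[i := c]) ≠ 0`», give the SAME value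
`𝐓_k(s,S)[W′] Φ ω = 𝐓_k(s,S)[W] Φ ω` at every `Amb` configuration `ω`.  (Induction over the generations `m ≤ k` on values: generation `m` modifies component `m`
only, so the outer certificates `i > m` stay alive inside, and `ζ_m(ω_y) ≠ 0` makes `ω_y` the `A_m`-fibre-mate for the inner call.)
[cite: Balaban1988Convergent, (2.20)–(2.21) p.258, (3.24) p.270, (2.10) p.256] -/
theorem tkBranchOfRecord_congr_on_joint_support_fine₂ (W W' : TkWeights F N V K) {n : ℕ} (s : SeqOfRecord F ν M g K n) (S : ℕ → Set (Site (F.P K) 0))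
    (k : ℕ) (Amb : MultiCfg (F.P K) (SU N) V → Prop)
    (hAmb : ∀ ω ω' : MultiCfg (F.P K) (SU N) V, (∀ i, k ≤ i → ω' i = ω i) → Amb ω → Amb ω')
    (hζ : ∀ j, j < k → W'.ζ j (s.Ω (j + 1))ᶜ = W.ζ j (s.Ω (j + 1))ᶜ)
    (hζloc : ∀ j, j < k → ∀ ω ω' : MultiCfg (F.P K) (SU N) V, ω j = ω' j → (ω (j + 1)).1 = (ω' (j + 1)).1 →
      W.ζ j (s.Ω (j + 1))ᶜ ω = W.ζ j (s.Ω (j + 1))ᶜ ω')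
    (hw : ∀ j, j < k → ∀ ω' : MultiCfg (F.P K) (SU N) V, Amb ω' →
      (∀ i, j ≤ i → i < k → ∃ c : JCfg (F.P K) i (SU N) V, c.1 = (ω' i).1 ∧
        (∀ b, b ∉ bondsIn i ((s.Λ (i + 1))ᶜ ∩ s.Ω (i + 1)) → c.2 b = (ω' i).2 b) ∧ W.ζ i (s.Ω (i + 1))ᶜ (Function.update ω' i c) ≠ 0) →
      W'.w j (s.Λ (j + 1)) ((s.Λ (j + 1))ᶜ ∩ s.Ω (j + 1)) (S (j + 1)) ω' = W.w j (s.Λ (j + 1)) ((s.Λ (j + 1))ᶜ ∩ s.Ω (j + 1)) (S (j + 1)) ω')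
    (Φ : MultiCfg (F.P K) (SU N) V → ℝ) (ω : MultiCfg (F.P K) (SU N) V) (hω : Amb ω) :
    tkBranchOfRecord F N V ν M g K W' s S k Φ ω = tkBranchOfRecord F N V ν M g K W s S k Φ ω := by
  -- the induction over the generations, on VALUES, carrying the ambient predicate and the certificates of the generations `≥ m`
  have key : ∀ m, m ≤ k → ∀ ω : MultiCfg (F.P K) (SU N) V, Amb ω →
      (∀ i, m ≤ i → i < k → ∃ c : JCfg (F.P K) i (SU N) V, c.1 = (ω i).1 ∧
        (∀ b, b ∉ bondsIn i ((s.Λ (i + 1))ᶜ ∩ s.Ω (i + 1)) → c.2 b = (ω i).2 b) ∧ W.ζ i (s.Ω (i + 1))ᶜ (Function.update ω i c) ≠ 0) →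
      tkBranchOfRecord F N V ν M g K W' s S m Φ ω = tkBranchOfRecord F N V ν M g K W s S m Φ ω := by
    intro m
    induction m with
    | zero => intro _ ω _ _; rfl
    | succ m ih =>
        intro hm ω hAω hsupp
        have hmk : m < k := Nat.lt_of_succ_le hm
        -- 11a's generations carry the CLASSICAL `DecidableEq` on bonds
        letI hdec : DecidableEq (PBond (F.P K) m) := fun a b => Classical.propDecidable (a = b)
        rw [tkBranchOfRecord_succ, tkBranchOfRecord_succ]
        simp only [genOp_apply, vOp_apply, zetaOp_apply]
        show kernelRTOfRecord F N K m _ _ _ _ = kernelRTOfRecord F N K m _ _ _ _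
        congr 1
        funext y
        -- the configuration after the V-update of generation `m`
        set ωy : MultiCfg (F.P K) (SU N) V := Function.update ω m
          (Function.updateFinset (ω m).1 (Set.toFinite (bondsIn m (s.Ω (m + 1))ᶜ)).toFinset y, (ω m).2) with hωy
        have hωy_ne : ∀ i, i ≠ m → ωy i = ω i := fun i hi => by rw [hωy, Function.update_of_ne hi]
        show W'.ζ m (s.Ω (m + 1))ᶜ ωy * _ = W.ζ m (s.Ω (m + 1))ᶜ ωy * _
        rw [hζ m hmk]
        by_cases hζ0 : W.ζ m (s.Ω (m + 1))ᶜ ωy = 0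
        · rw [hζ0, zero_mul, zero_mul]
        · congr 1
          rw [aOp_apply, aOp_apply]
          refine congrArg (fun φ : (↥(Set.toFinite (bondsIn m ((s.Λ (m + 1))ᶜ ∩ s.Ω (m + 1)))).toFinset → V) → ℝ =>
            ∫ a, φ a ∂(Measure.pi fun _ => (volume : Measure V))) (funext fun a => ?_)
          -- the configuration after the A-update: on the `A_m`-fibre of `ωy`, components `≠ m` untouched
          set ωa : MultiCfg (F.P K) (SU N) V := Function.update ωy m
            (insA (Set.toFinite (bondsIn m ((s.Λ (m + 1))ᶜ ∩ s.Ω (m + 1)))).toFinset a (ωy m)) with hωa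
          have hωa_ne : ∀ i, i ≠ m → ωa i = ω i := fun i hi => by rw [hωa, Function.update_of_ne hi, hωy_ne i hi]
          have hωa_m1 : (ωa m).1 = (ωy m).1 := by rw [hωa, Function.update_self]; rfl
          have hωa_m2 : ∀ b, b ∉ bondsIn m ((s.Λ (m + 1))ᶜ ∩ s.Ω (m + 1)) → (ωy m).2 b = (ωa m).2 b := fun b hb => by
            have h' : (ωa m).2 b = (ωy m).2 b := by
              rw [hωa, Function.update_self]
              show Function.updateFinset (ωy m).2 _ a b = (ωy m).2 b
              rw [Function.updateFinset_def]
              exact dif_neg fun h => hb ((Set.Finite.mem_toFinset _).mp h)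
            exact h'.symm
          have hωa_back : Function.update ωa m (ωy m) = ωy := by
            rw [hωa, Function.update_idem, Function.update_eq_self]
          have hAa : Amb ωa := hAmb ω ωa (fun i hi => hωa_ne i (Nat.ne_of_lt (lt_of_lt_of_le hmk hi)).symm) hAω
          -- the joint support at `ωa` for every `i ∈ [m, k)`
          have hsuppa : ∀ i, m ≤ i → i < k → ∃ c : JCfg (F.P K) i (SU N) V, c.1 = (ωa i).1 ∧
              (∀ b, b ∉ bondsIn i ((s.Λ (i + 1))ᶜ ∩ s.Ω (i + 1)) → c.2 b = (ωa i).2 b) ∧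
              W.ζ i (s.Ω (i + 1))ᶜ (Function.update ωa i c) ≠ 0 := by
            intro i hmi hik
            by_cases him : i = m
            · subst him
              refine ⟨ωy i, hωa_m1.symm, hωa_m2, ?_⟩
              rw [hωa_back]
              exact hζ0
            · obtain ⟨c, hc1, hc2, hcζ⟩ := hsupp i (by omega) hik
              refine ⟨c, by rw [hωa_ne i him]; exact hc1, fun b hb => by rw [hωa_ne i him]; exact hc2 b hb, ?_⟩
              rw [hζloc i hik (Function.update ωa i c) (Function.update ω i c) (by rw [Function.update_self, Function.update_self])
                (by rw [Function.update_of_ne (Nat.succ_ne_self i), Function.update_of_ne (Nat.succ_ne_self i), hωa_ne (i + 1) (by omega)])]  -- FINE form: only `.1` of component `i+1` is asked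
              exact hcζ
          show W'.w m (s.Λ (m + 1)) ((s.Λ (m + 1))ᶜ ∩ s.Ω (m + 1)) (S (m + 1)) ωa * tkBranchOfRecord F N V ν M g K W' s S m Φ ωa =
            W.w m (s.Λ (m + 1)) ((s.Λ (m + 1))ᶜ ∩ s.Ω (m + 1)) (S (m + 1)) ωa * tkBranchOfRecord F N V ν M g K W s S m Φ ωa
          rw [hw m hmk ωa hAa hsuppa, ih hmk.le ωa hAa hsuppa]
  exact key k le_rfl ω hω (fun i hi hik => absurd hik (not_lt.mpr hi))

end S1

section S2

variable {F : T4Family} {N : ℕ} [NeZero N] {V : Type} [NormedAddCommGroup V] [InnerProductSpace ℝ V] [FiniteDimensional ℝ V]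
  [MeasurableSpace V] [BorelSpace V]
variable (ν : Stage7Numerics) (M : ℕ) (g : ℕ → ℝ) (K : ℕ)
variable (W : TkWeights F N V K)

/-- **★★ (FINE TWO-SCALE EDITION of p598996 §2) `U₀ ↦ f(U₀)·𝐓_k(s,S)[Φ](base_k U₀)` IS INTEGRABLE UNDER A-FIBRE DOMINATION ON THE JOINT SUPPORT** — dag-n11-d's C2 §5 with a bounded measurable FRONT
FACTOR `f` (the step's own weight `χ_k·w_k`, read at the level-`k` gauge component) and its domination row WEAKENED to: for `j < k`, at every configuration `ω′` with
`f((ω′ k).1) ≠ 0` AND the joint support condition «∀ i ∈ [j,k), ∃ c agreeing with `ω′ i` in the gauge part and off the `A_i`-bonds, `ζ_i((Ω_{i+1})ᶜ)(ω′[i := c]) ≠ 0`»,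
`ofReal (w_j ω′) ≤ ŵ_j(A_j ω′|_{sA_j})`.  Requires the FINE two-scale locality of `ζ_i` (`i < k`).  PROOF: guarded weights `χ_A′ := 𝟙[row]·χ_A` (dominated everywhere ⇒ C2 §5 ⇒
`f·𝐓_k[W′]` integrable by `Integrable.mul_bdd`), and `f(U₀)·𝐓_k[W′](base U₀) = f(U₀)·𝐓_k[W](base U₀)` by §1 with the ambient predicate `f((ω k).1) ≠ 0` (the generations
`< k` never touch component `k`, which is `U₀` at the base configuration). [cite: Balaban1988Convergent, (2.18) p.257, (2.20)–(2.21) p.258, (3.23)–(3.24) p.270, (2.10) p.256] -/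
theorem integrable_front_mul_tkBranchOfRecord_baseCfg_of_dominated_on_joint_support_fine₂ {n : ℕ} (s : SeqOfRecord F ν M g K n)
    (S : ℕ → Set (Site (F.P K) 0)) (k : ℕ)
    (hζm : ∀ j, Measurable (W.ζ j (s.Ω (j + 1))ᶜ)) (hζ0 : ∀ j ω, 0 ≤ W.ζ j (s.Ω (j + 1))ᶜ ω) (hζ1 : ∀ j ω, W.ζ j (s.Ω (j + 1))ᶜ ω ≤ 1)
    (hζloc : ∀ j, j < k → ∀ ω ω' : MultiCfg (F.P K) (SU N) V, ω j = ω' j → (ω (j + 1)).1 = (ω' (j + 1)).1 →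
      W.ζ j (s.Ω (j + 1))ᶜ ω = W.ζ j (s.Ω (j + 1))ᶜ ω')
    (hwm : ∀ j, Measurable (W.w j (s.Λ (j + 1)) ((s.Λ (j + 1))ᶜ ∩ s.Ω (j + 1)) (S (j + 1))))
    (hw0 : ∀ j ω, 0 ≤ W.w j (s.Λ (j + 1)) ((s.Λ (j + 1))ᶜ ∩ s.Ω (j + 1)) (S (j + 1)) ω)
    (ŵ : (j : ℕ) → (↥(Set.toFinite (bondsIn j ((s.Λ (j + 1))ᶜ ∩ s.Ω (j + 1)))).toFinset → V) → ℝ≥0∞) (hŵm : ∀ j, Measurable (ŵ j))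
    (f : GaugeField (F.P K) k (SU N) → ℝ) (hfm : Measurable f) (Cf : ℝ) (hfb : ∀ U, |f U| ≤ Cf)
    (hdom : ∀ j, j < k → ∀ ω' : MultiCfg (F.P K) (SU N) V, f (ω' k).1 ≠ 0 →
      (∀ i, j ≤ i → i < k → ∃ c : JCfg (F.P K) i (SU N) V, c.1 = (ω' i).1 ∧
        (∀ b, b ∉ bondsIn i ((s.Λ (i + 1))ᶜ ∩ s.Ω (i + 1)) → c.2 b = (ω' i).2 b) ∧ W.ζ i (s.Ω (i + 1))ᶜ (Function.update ω' i c) ≠ 0) →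
      ENNReal.ofReal (W.w j (s.Λ (j + 1)) ((s.Λ (j + 1))ᶜ ∩ s.Ω (j + 1)) (S (j + 1)) ω') ≤
        ŵ j (fun b : ↥(Set.toFinite (bondsIn j ((s.Λ (j + 1))ᶜ ∩ s.Ω (j + 1)))).toFinset => (ω' j).2 b))
    (Cw : ℕ → ℝ≥0) (hCw : ∀ j, ∫⁻ a, ŵ j a ∂(Measure.pi fun _ : ↥(Set.toFinite (bondsIn j ((s.Λ (j + 1))ᶜ ∩ s.Ω (j + 1)))).toFinset => (volume : Measure V)) ≤ Cw j)
    {Φ : MultiCfg (F.P K) (SU N) V → ℝ} (hΦm : Measurable Φ) (hΦ0 : ∀ ω, 0 ≤ Φ ω) (CΦ : ℝ) (hΦle : ∀ ω, Φ ω ≤ CΦ) :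
    Integrable (fun U₀ : GaugeField (F.P K) k (SU N) => f U₀ * tkBranchOfRecord F N V ν M g K W s S k Φ (baseCfg k U₀))
      (fieldMeasure (F.P K) k (SU N)) := by
  -- the guard sets and the guarded weights (as in `…N11AFibreDominationOnSupport` §2)
  let Gd : ℕ → Set (MultiCfg (F.P K) (SU N) V) := fun j =>
    {ω | ENNReal.ofReal (W.w j (s.Λ (j + 1)) ((s.Λ (j + 1))ᶜ ∩ s.Ω (j + 1)) (S (j + 1)) ω) ≤
      ŵ j (fun b : ↥(Set.toFinite (bondsIn j ((s.Λ (j + 1))ᶜ ∩ s.Ω (j + 1)))).toFinset => (ω j).2 b)}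
  have hproj : ∀ j, Measurable (fun ω : MultiCfg (F.P K) (SU N) V =>
      (fun b : ↥(Set.toFinite (bondsIn j ((s.Λ (j + 1))ᶜ ∩ s.Ω (j + 1)))).toFinset => (ω j).2 b)) := fun j =>
    measurable_pi_lambda _ fun b => (measurable_pi_apply (b : PBond (F.P K) j)).comp (measurable_snd.comp (measurable_pi_apply j))
  have hGd : ∀ j, MeasurableSet (Gd j) := fun j => measurableSet_le (hwm j).ennreal_ofReal ((hŵm j).comp (hproj j))
  let W' : TkWeights F N V K := ⟨W.ζ, W.quad, fun j Y S' => (Gd j).indicator (W.chiA j Y S')⟩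
  have hw' : ∀ (j : ℕ) (Λ' Y S' : Set (Site (F.P K) 0)), W'.w j Λ' Y S' = (Gd j).indicator (W.w j Λ' Y S') := by
    intro j Λ' Y S'
    funext ω
    show (Gd j).indicator (W.chiA j Y S') ω * Real.exp (-(1 / 2 : ℝ) * W.quad j Λ' ω) =
      (Gd j).indicator (fun ω => W.chiA j Y S' ω * Real.exp (-(1 / 2 : ℝ) * W.quad j Λ' ω)) ω
    exact (Set.indicator_mul_left (Gd j) (W.chiA j Y S') (fun ω => Real.exp (-(1 / 2 : ℝ) * W.quad j Λ' ω))).symm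
  have hwm' : ∀ j, Measurable (W'.w j (s.Λ (j + 1)) ((s.Λ (j + 1))ᶜ ∩ s.Ω (j + 1)) (S (j + 1))) := fun j => by
    rw [hw']
    exact (hwm j).indicator (hGd j)
  have hw0' : ∀ j ω, 0 ≤ W'.w j (s.Λ (j + 1)) ((s.Λ (j + 1))ᶜ ∩ s.Ω (j + 1)) (S (j + 1)) ω := fun j ω => by
    rw [hw']
    exact Set.indicator_nonneg (fun ω _ => hw0 j ω) ω
  have hdom' : ∀ j ω, ENNReal.ofReal (W'.w j (s.Λ (j + 1)) ((s.Λ (j + 1))ᶜ ∩ s.Ω (j + 1)) (S (j + 1)) ω) ≤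
      ŵ j (fun b : ↥(Set.toFinite (bondsIn j ((s.Λ (j + 1))ᶜ ∩ s.Ω (j + 1)))).toFinset => (ω j).2 b) := fun j ω => by
    rw [hw']
    by_cases hω : ω ∈ Gd j
    · rw [Set.indicator_of_mem hω]
      exact hω
    · rw [Set.indicator_of_notMem hω, ENNReal.ofReal_zero]
      exact bot_le
  -- C2 §5 at the guarded weights, times the bounded front factor
  have hB : Integrable (fun U₀ : GaugeField (F.P K) k (SU N) => tkBranchOfRecord F N V ν M g K W' s S k Φ (baseCfg k U₀))
      (fieldMeasure (F.P K) k (SU N)) :=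
    integrable_tkBranchOfRecord_baseCfg_of_dominated ν M g K W' s S hζm hζ0 hζ1 hwm' hw0' ŵ hŵm hdom' Cw hCw hΦm hΦ0 CΦ hΦle k
  have hBf : Integrable (fun U₀ : GaugeField (F.P K) k (SU N) => tkBranchOfRecord F N V ν M g K W' s S k Φ (baseCfg k U₀) * f U₀)
      (fieldMeasure (F.P K) k (SU N)) :=
    hB.mul_bdd hfm.aestronglyMeasurable (c := Cf) (Filter.Eventually.of_forall fun U₀ => by rw [Real.norm_eq_abs]; exact hfb U₀)
  -- on `f ≠ 0` the two branch operators agree at the base configuration (§1 with the ambient predicate `f((ω k).1) ≠ 0`)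
  have heq : (fun U₀ : GaugeField (F.P K) k (SU N) => f U₀ * tkBranchOfRecord F N V ν M g K W s S k Φ (baseCfg k U₀)) =
      fun U₀ => tkBranchOfRecord F N V ν M g K W' s S k Φ (baseCfg k U₀) * f U₀ := by
    funext U₀
    by_cases hf0 : f U₀ = 0
    · rw [hf0, zero_mul, mul_zero]
    · rw [mul_comm]
      congr 1
      refine (tkBranchOfRecord_congr_on_joint_support_fine₂ ν M g K W W' s S k (fun ω => f (ω k).1 ≠ 0) (fun ω ω' hag hω => ?_)
        (fun j _ => rfl) hζloc (fun j hj ω' hAω hsupp => ?_) Φ (baseCfg k U₀) ?_).symm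
      · rw [hag k le_rfl]; exact hω
      · rw [hw']
        refine Set.indicator_of_mem ?_ _
        exact hdom j hj ω' hAω hsupp
      · show f ((baseCfg (V := V) k U₀) k).1 ≠ 0
        rw [show ((baseCfg (V := V) k U₀) k).1 = U₀ from funext fun b => baseCfg_fst_self (V := V) k U₀ b]
        exact hf0
  rw [heq]
  exact hBf

end S2

end Summit.QuantumFields.YangMills.Theorems.BalabanUVNodesN11JointSupportFineTwoScaleRoots

end
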